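import Summits.ValiantsHypothesis.ValiantsHypothesis.Theorems.BarrierLeverChowBenchmarkPairsBlockPeelCert1459
import Summits.ValiantsHypothesis.ValiantsHypothesis.Theorems.BarrierLeverChowBenchmarkPairsBlockPeelCover
import Summits.ValiantsHypothesis.ValiantsHypothesis.Theorems.BarrierLeverChowBenchmarkPairsBlockPeelCertBX1460
import Summits.ValiantsHypothesis.ValiantsHypothesis.Theorems.BarrierLeverChowBenchmarkPairsBlockPeelCertB1494
import Summits.ValiantsHypothesis.ValiantsHypothesis.Theorems.BarrierLeverChowBenchmarkPairsBlockPeelCertB1496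
import Summits.ValiantsHypothesis.ValiantsHypothesis.Theorems.BarrierLeverChowBenchmarkPairsBlockPeelCertR1459x2
/-!
# Route BarrierLever — item 22038 `ChowBenchmarkPairs`, line `moore-peel`: RUNG 1773 OF THE COMPUTATIONAL LANE by a GOOD COVER
# (not a P′ tiling): node #1 `SegmentMeanValueAt h` for EVERY `h ≤ 1773` (`Lean.ofReduceBool`)

Helper file, **computational (inherited from the block certificates)** (`--computational --supports stmt-ValiantsHypothesis-22038`; cell
valiant-natproofs, rung V4, 𝒟-side benchmark of record, line `moore_peel`; seat val-np-p4 gen 30).  Closes NO item.  Two list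
definitions (`coverInteriorA/B`, the interior stages of the covers).

THE COVER.  Bad stages of THEOREM W below `1774`: `183, 364, 444, 573, 628, 725, 726, 892, 959, 1149, 1460, 1461, 1494, 1496`.  The P′
block of the 2-run `1460–61` is `{1459,1460,1461}` (`4 380²`, beyond the gate's budget); instead the cover uses the EXACT-RUN double
`{1460, 1461}` (`…CertBX1460`, `2 921²`) for heights `h ≥ 1461` (variant A, cuts = stages outside `coverInteriorA`) and the prefix block
`{1459, 1460}` (`…CertR1459x2`) at the single height `h = 1460` (variant B).  All other bad stages are covered as in rung 1459 plus the
2-blocks `{1493,1494}`, `{1495,1496}`.  The tiling theorem is `kernelPoisedAt_factorial_of_cutPred` (`…BlockPeelCover`).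

* `cover_blocks_A/B` (every pair of consecutive cuts spans a certified block or a good single), **`segmentMeanValueAt_of_le_1773_cert`**
  (node #1 VERBATIM ∀ `h ≤ 1773`), **`chowBenchmarkPairs_body_of_le_1773_cert`**.

RANGES OF NODE #1 (R43 (b)): KERNEL `h ≤ 182` · COMPUTATIONAL `h ≤ 1773` (this file; `1459` by `…Cert1459`) · NUMERICAL `h ≤ 20 069` ·
CONJECTURAL ∀ h.

WHAT THIS IS NOT: node #1 (∀ h) and the item are NOT closed; nothing on crux stmt-ValiantsHypothesis-14610 or on `VP` versus `VNP`.
-/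

set_option linter.dupNamespace false

namespace Summit.ValiantsHypothesis.ValiantsHypothesis.Theorems.BarrierLever.MoorePeel

/-- The interior stages of the cover (A). -/
def coverInteriorA : List ℕ := [183, 364, 444, 573, 628, 725, 726, 892, 959, 1149, 1461, 1494, 1496]

/-- THEOREM W's table: every bad stage `≤ 1773` is an interior stage of the cover or the start `1460` of the exact double
(variant A) / `1461` beyond the height (variant B). -/
theorem bad_le_1773_A : ∀ b ∈ badStagesLe5000, b ≤ 1773 → b ∈ coverInteriorA ∨ b = 1460 := by
  decide

/-- **The cover tiling, variant A**: consecutive cuts (stages not in `coverInteriorA`) span good blocks. -/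
theorem cover_blocks_A (h : ℕ) (hh : h ≤ 1773) (hvar : h ≠ 1460)
    (c c' : ℕ) (h1c : 1 ≤ c) (hcc' : c < c') (hc'h : c' ≤ h + 1) (hPc : c ∉ coverInteriorA)
    (hPc' : c' ∉ coverInteriorA ∨ c' = h + 1) (hgap : ∀ x, c < x → x < c' → ¬ (x ∉ coverInteriorA)) :
    (blockMatrix Nat.factorial c (c' - c) (fun s : Fin (c' - c) => (MvPolynomial.X s : MvPolynomial (Fin (c' - c)) ℤ))).det ≠ 0 := by
  have hgap' : ∀ x, c < x → x < c' → x ∈ coverInteriorA := fun x h1 h2 => by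
    have := hgap x h1 h2; push Not at this; exact this
  clear hgap
  have hgap := fun x (h1 : c < x) (h2 : x < c') (hn : x ∉ coverInteriorA) => hn (hgap' x h1 h2)
  by_cases hsingle : c' = c + 1
  · -- a single: `c` is a good stage (not interior, not the exact-double start)
    subst hsingle
    rw [Nat.add_sub_cancel_left]
    refine det_blockMatrix_factorial_one_ne_zero c fun h0 => ?_
    have hmem : c ∈ badStagesLe5000 := (det_peelMatrix_eq_zero_iff_mem_of_le_5000 c h1c (by omega)).mp h0
    rcases bad_le_1773_A c hmem (by omega) with hI | hc0
    · exact hPc hI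
    · -- c = the exact-double start: then c + 1 is interior, contradicting that c + 1 = c' is a cut (or h+1)
      rcases hPc' with hn | he
      · exact hn (by rw [hc0]; decide)
      · omega
  · -- a special block: `c + 1` is interior
    have hin : c + 1 ∈ coverInteriorA := hgap' (c + 1) (by omega) (by omega)
    simp only [coverInteriorA, List.mem_cons, List.not_mem_nil, or_false] at hin
    rcases hin with h1 | h1 | h1 | h1 | h1 | h1 | h1 | h1 | h1 | h1 | h1 | h1 | h1
    · -- c = 182
      obtain rfl : c = 182 := by omega
      have hc'le : c' ≤ 184 := by
        by_contra hgt
        exact hgap 184 (by omega) (by omega) (by decide)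
      obtain rfl : c' = 184 := by omega
      exact det_blockMatrix_182_2_ne_zero
    · -- c = 363
      obtain rfl : c = 363 := by omega
      have hc'le : c' ≤ 365 := by
        by_contra hgt
        exact hgap 365 (by omega) (by omega) (by decide)
      obtain rfl : c' = 365 := by omega
      exact det_blockMatrix_363_2_ne_zero
    · -- c = 443
      obtain rfl : c = 443 := by omega
      have hc'le : c' ≤ 445 := by
        by_contra hgt
        exact hgap 445 (by omega) (by omega) (by decide)
      obtain rfl : c' = 445 := by omega
      exact det_blockMatrix_443_2_ne_zero
    · -- c = 572
      obtain rfl : c = 572 := by omega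
      have hc'le : c' ≤ 574 := by
        by_contra hgt
        exact hgap 574 (by omega) (by omega) (by decide)
      obtain rfl : c' = 574 := by omega
      exact det_blockMatrix_572_2_ne_zero
    · -- c = 627
      obtain rfl : c = 627 := by omega
      have hc'le : c' ≤ 629 := by
        by_contra hgt
        exact hgap 629 (by omega) (by omega) (by decide)
      obtain rfl : c' = 629 := by omega
      exact det_blockMatrix_627_2_ne_zero
    · -- c = 724
      obtain rfl : c = 724 := by omega
      have hc'le : c' ≤ 727 := by
        by_contra hgt
        exact hgap 727 (by omega) (by omega) (by decide)
      have hc'cases : c' = 726 ∨ c' = 727 := by omega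
      rcases hc'cases with rfl | rfl
      · exact det_blockMatrix_724_2_ne_zero
      · exact det_blockMatrix_724_3_ne_zero
    · -- c = 725 is an interior stage, not a cut
      exfalso; exact hPc (by rw [show c = 725 by omega]; decide)
    · -- c = 891
      obtain rfl : c = 891 := by omega
      have hc'le : c' ≤ 893 := by
        by_contra hgt
        exact hgap 893 (by omega) (by omega) (by decide)
      obtain rfl : c' = 893 := by omega
      exact det_blockMatrix_891_2_ne_zero
    · -- c = 958
      obtain rfl : c = 958 := by omega
      have hc'le : c' ≤ 960 := by
        by_contra hgt
        exact hgap 960 (by omega) (by omega) (by decide)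
      obtain rfl : c' = 960 := by omega
      exact det_blockMatrix_958_2_ne_zero
    · -- c = 1148
      obtain rfl : c = 1148 := by omega
      have hc'le : c' ≤ 1150 := by
        by_contra hgt
        exact hgap 1150 (by omega) (by omega) (by decide)
      obtain rfl : c' = 1150 := by omega
      exact det_blockMatrix_1148_2_ne_zero
    · -- c = 1460
      obtain rfl : c = 1460 := by omega
      have hc'le : c' ≤ 1462 := by
        by_contra hgt
        exact hgap 1462 (by omega) (by omega) (by decide)
      obtain rfl : c' = 1462 := by omega
      exact det_blockMatrix_1460_2_ne_zero
    · -- c = 1493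
      obtain rfl : c = 1493 := by omega
      have hc'le : c' ≤ 1495 := by
        by_contra hgt
        exact hgap 1495 (by omega) (by omega) (by decide)
      obtain rfl : c' = 1495 := by omega
      exact det_blockMatrix_1493_2_ne_zero
    · -- c = 1495
      obtain rfl : c = 1495 := by omega
      have hc'le : c' ≤ 1497 := by
        by_contra hgt
        exact hgap 1497 (by omega) (by omega) (by decide)
      obtain rfl : c' = 1497 := by omega
      exact det_blockMatrix_1495_2_ne_zero

/-- The interior stages of the cover (B). -/
def coverInteriorB : List ℕ := [183, 364, 444, 573, 628, 725, 726, 892, 959, 1149, 1460, 1494, 1496]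

/-- THEOREM W's table: every bad stage `≤ 1773` is an interior stage of the cover or the start `1460` of the exact double
(variant A) / `1461` beyond the height (variant B). -/
theorem bad_le_1773_B : ∀ b ∈ badStagesLe5000, b ≤ 1773 → b ∈ coverInteriorB ∨ b = 1461 := by
  decide

/-- **The cover tiling, variant B**: consecutive cuts (stages not in `coverInteriorB`) span good blocks. -/
theorem cover_blocks_B (h : ℕ) (_hh : h ≤ 1773) (hvar : h = 1460)
    (c c' : ℕ) (h1c : 1 ≤ c) (hcc' : c < c') (hc'h : c' ≤ h + 1) (hPc : c ∉ coverInteriorB)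
    (hPc' : c' ∉ coverInteriorB ∨ c' = h + 1) (hgap : ∀ x, c < x → x < c' → ¬ (x ∉ coverInteriorB)) :
    (blockMatrix Nat.factorial c (c' - c) (fun s : Fin (c' - c) => (MvPolynomial.X s : MvPolynomial (Fin (c' - c)) ℤ))).det ≠ 0 := by
  have hgap' : ∀ x, c < x → x < c' → x ∈ coverInteriorB := fun x h1 h2 => by
    have := hgap x h1 h2; push Not at this; exact this
  clear hgap
  have hgap := fun x (h1 : c < x) (h2 : x < c') (hn : x ∉ coverInteriorB) => hn (hgap' x h1 h2)
  by_cases hsingle : c' = c + 1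
  · -- a single: `c` is a good stage (not interior, not the exact-double start)
    subst hsingle
    rw [Nat.add_sub_cancel_left]
    refine det_blockMatrix_factorial_one_ne_zero c fun h0 => ?_
    have hmem : c ∈ badStagesLe5000 := (det_peelMatrix_eq_zero_iff_mem_of_le_5000 c h1c (by omega)).mp h0
    rcases bad_le_1773_B c hmem (by omega) with hI | hc0
    · exact hPc hI
    · -- c = 1461 > h = 1460: impossible
      omega
  · -- a special block: `c + 1` is interior
    have hin : c + 1 ∈ coverInteriorB := hgap' (c + 1) (by omega) (by omega)
    simp only [coverInteriorB, List.mem_cons, List.not_mem_nil, or_false] at hin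
    rcases hin with h1 | h1 | h1 | h1 | h1 | h1 | h1 | h1 | h1 | h1 | h1 | h1 | h1
    · -- c = 182
      obtain rfl : c = 182 := by omega
      have hc'le : c' ≤ 184 := by
        by_contra hgt
        exact hgap 184 (by omega) (by omega) (by decide)
      obtain rfl : c' = 184 := by omega
      exact det_blockMatrix_182_2_ne_zero
    · -- c = 363
      obtain rfl : c = 363 := by omega
      have hc'le : c' ≤ 365 := by
        by_contra hgt
        exact hgap 365 (by omega) (by omega) (by decide)
      obtain rfl : c' = 365 := by omega
      exact det_blockMatrix_363_2_ne_zero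
    · -- c = 443
      obtain rfl : c = 443 := by omega
      have hc'le : c' ≤ 445 := by
        by_contra hgt
        exact hgap 445 (by omega) (by omega) (by decide)
      obtain rfl : c' = 445 := by omega
      exact det_blockMatrix_443_2_ne_zero
    · -- c = 572
      obtain rfl : c = 572 := by omega
      have hc'le : c' ≤ 574 := by
        by_contra hgt
        exact hgap 574 (by omega) (by omega) (by decide)
      obtain rfl : c' = 574 := by omega
      exact det_blockMatrix_572_2_ne_zero
    · -- c = 627
      obtain rfl : c = 627 := by omega
      have hc'le : c' ≤ 629 := by
        by_contra hgt
        exact hgap 629 (by omega) (by omega) (by decide)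
      obtain rfl : c' = 629 := by omega
      exact det_blockMatrix_627_2_ne_zero
    · -- c = 724
      obtain rfl : c = 724 := by omega
      have hc'le : c' ≤ 727 := by
        by_contra hgt
        exact hgap 727 (by omega) (by omega) (by decide)
      have hc'cases : c' = 726 ∨ c' = 727 := by omega
      rcases hc'cases with rfl | rfl
      · exact det_blockMatrix_724_2_ne_zero
      · exact det_blockMatrix_724_3_ne_zero
    · -- c = 725 is an interior stage, not a cut
      exfalso; exact hPc (by rw [show c = 725 by omega]; decide)
    · -- c = 891
      obtain rfl : c = 891 := by omega
      have hc'le : c' ≤ 893 := by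
        by_contra hgt
        exact hgap 893 (by omega) (by omega) (by decide)
      obtain rfl : c' = 893 := by omega
      exact det_blockMatrix_891_2_ne_zero
    · -- c = 958
      obtain rfl : c = 958 := by omega
      have hc'le : c' ≤ 960 := by
        by_contra hgt
        exact hgap 960 (by omega) (by omega) (by decide)
      obtain rfl : c' = 960 := by omega
      exact det_blockMatrix_958_2_ne_zero
    · -- c = 1148
      obtain rfl : c = 1148 := by omega
      have hc'le : c' ≤ 1150 := by
        by_contra hgt
        exact hgap 1150 (by omega) (by omega) (by decide)
      obtain rfl : c' = 1150 := by omega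
      exact det_blockMatrix_1148_2_ne_zero
    · -- c = 1459
      obtain rfl : c = 1459 := by omega
      have hc'le : c' ≤ 1461 := by
        by_contra hgt
        exact hgap 1461 (by omega) (by omega) (by decide)
      obtain rfl : c' = 1461 := by omega
      exact det_blockMatrix_1459_2_ne_zero
    · -- c = 1493
      obtain rfl : c = 1493 := by omega
      have hc'le : c' ≤ 1495 := by
        by_contra hgt
        exact hgap 1495 (by omega) (by omega) (by decide)
      obtain rfl : c' = 1495 := by omega
      exact det_blockMatrix_1493_2_ne_zero
    · -- c = 1495
      obtain rfl : c = 1495 := by omega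
      have hc'le : c' ≤ 1497 := by
        by_contra hgt
        exact hgap 1497 (by omega) (by omega) (by decide)
      obtain rfl : c' = 1497 := by omega
      exact det_blockMatrix_1495_2_ne_zero

/-- **`KernelPoisedAt k! h` for every `h ≤ 1773`** (computational lane), by the cover. -/
theorem kernelPoisedAt_factorial_of_le_1773_cert (h : ℕ) (hh : h ≤ 1773) : KernelPoisedAt Nat.factorial h := by
  classical
  by_cases hvar : h = 1460
  · exact kernelPoisedAt_factorial_of_cutPred h (fun c => c ∉ coverInteriorB) (by decide)
      (fun c c' h1 h2 h3 h4 h5 h6 => cover_blocks_B h hh hvar c c' h1 h2 h3 h4 h5 h6)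
  · exact kernelPoisedAt_factorial_of_cutPred h (fun c => c ∉ coverInteriorA) (by decide)
      (fun c c' h1 h2 h3 h4 h5 h6 => cover_blocks_A h hh hvar c c' h1 h2 h3 h4 h5 h6)

/-- **`SegmentMeanValueAt h` for EVERY `h ≤ 1773`, VERBATIM (computational lane, `Lean.ofReduceBool`).** -/
theorem segmentMeanValueAt_of_le_1773_cert (h : ℕ) (hh : h ≤ 1773) :
    ∀ (r : ℕ) (u : Fin r → Finset (Fin h)), Function.Injective u → (∀ i, (u i).card ≤ 2) →
      (∀ S : Finset (Fin h), S.card ≤ 2 → ∃ i, u i = S) →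
      ∃ P : Fin h → Fin h → ℂ,
        (Matrix.of fun i j : Fin r =>
          ∑ g : (↥(benchCols h r j) → ↥(u i)), (∏ c : ↥(benchCols h r j), P (g c) c) *
            ∏ a : ↥(u i),
              ((Finset.univ.filter fun c : ↥(benchCols h r j) => g c = a).card.factorial : ℂ)).det ≠ 0 :=
  kernelPoisedAt_factorial_of_le_1773_cert h hh

/-- **The body of item 22038 `ChowBenchmarkPairs` for every `h ≤ 1773`** (computational lane), by the zeon dualisation. -/
theorem chowBenchmarkPairs_body_of_le_1773_cert (h : ℕ) (hh : h ≤ 1773) :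
    ∀ (r : ℕ) (u : Fin r → Finset (Fin h)), Function.Injective u → (∀ i, (u i).card ≤ 2) →
      (∀ S : Finset (Fin h), S.card ≤ 2 → ∃ i, u i = S) →
      ∃ B : Fin h → Fin h → ℂ,
        (Matrix.of fun i j : Fin r => MvPolynomial.coeff
          (∑ a ∈ u i, Finsupp.single (Fin.castAdd h a) 1 +
            ∑ c ∈ Finset.univ.filter (fun c : Fin h => Nat.testBit (j : ℕ) (c : ℕ)), Finsupp.single (Fin.natAdd h c) 1)
          (∏ a : Fin h, (MvPolynomial.X (Fin.castAdd h a) + 1 +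
            ∑ c : Fin h, MvPolynomial.C (B a c) * MvPolynomial.X (Fin.natAdd h c)))).det ≠ 0 :=
  ChowBenchmarkDual.stub_dualisation h (segmentMeanValueAt_of_le_1773_cert h hh)

end Summit.ValiantsHypothesis.ValiantsHypothesis.Theorems.BarrierLever.MoorePeel
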